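import Literature.NumberTheory.ConnesConsani2021.ProlateProjectionsProofs
import Literature.NumberTheory.ConnesConsani2021.SoninTraceReduction
import Literature.NumberTheory.LFunctions.ConnesProlateGuessSupNorm
import Literature.NumberTheory.ConnesConsani2021.ProlateProjectionsCompleteness
import Mathlib.Analysis.CStarAlgebra.ContinuousFunctionalCalculus.Commute
import HarnessLib

/-!
# Connes–Consani 2021, §4 — pairs of projections: eigenvectors of the angle operator, (angle_spectrum) from the completeness fact, and `λ(n) → 0`

RH-FREE corpus literature (Hilbert-space geometry of two orthogonal projections and the prolate
eigen-data at the archimedean place; no zeta zeros, no positivity statement, nothing here bears on the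
truth of RH).  Cell `rh-crit`, sub-cell `cc/`, overflow rows O5/O11 (seat gm-t14); bears_on W-C/W-P only
as background of the §4 input of the apex chain.  WHAT THIS IS NOT: a statement about RH.

A. Connes, C. Consani, *Weil positivity and trace formula, the archimedean place*, Selecta Math.
(N.S.) 27 (2021) 77 = arXiv:2006.13771 [bib: `ConnesConsani2021`], §4, Lemma 4.2 (= arXiv item
Lemma 22) and the displays (cosalpha) `𝒫₁𝒫̂₁𝒫₁ = cos²(α)𝒫₁`, (cosalphan1), "the non-zero eigenvalues
`α(n)` of `α` are given by `cos α(n) = |λ(n)|`", "`α` … is `0` on Sonin's space", "`λ(0) = 0.999971, …`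
and all the further ones decay very fast to `0`" (p. 16; locators `pNNNN:Lnn` = chunk:line of the held
text `paper:arxiv-2006.13771`, as in the statement layer `ProlateProjections.lean` of seat t3, whose
definitions `angleOp`, `absDiff`, `IsIrreduciblePair`, `cutoffProj`, `cutoffProjHat`, `prolateXi/Eta`,
`prolateEigen` and named facts we use and do not restate).  Lemma 4.2 (i)/(ii) themselves
(`angleOp_spec`, `CC2021_lem_4_2_ii_holds`, `CC2021_lem_4_2_i_holds`), Prop. 4.5 (i) and the Fourier
mirrors `cutoffProjHat_prolateXi/Eta`, `fourier_prolateEta` are seat t3's `ProlateProjectionsProofs.lean`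
(imported); the evenness bookkeeping `fourier_mem_evenPart`, `cutoffProj_mem_evenPart` is seat gm-t15's
`SoninTraceReduction.lean` (imported).  THEOREMS ONLY: no definition, no new named fact.

## What is proved here

| source item | Lean | status |
|---|---|---|
| Reed–Simon I, Thm. VII.1 (d): "If `Aψ = λψ`, then `φ(f)ψ = f(λ)ψ`" for the continuous functional calculus of a bounded self-adjoint `A` | `cfc_apply_of_apply_eq_smul` (+ `mem_spectrum_real_of_apply_eq_smul`, `cfcHom_apply_of_apply_eq_smul`) for Mathlib's real `cfc` on `H →L[ℂ] H` | PROVED (Stone–Weierstrass induction `ContinuousMap.induction_on_of_compact`, as in Mathlib's `Commute.cfcHom`) |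
| Lemma 4.2 (i), the mechanism: two spectral values of `∠(P₁,P₂)` give a proper non-zero closed subspace invariant under `P₁, P₂`; for an irreducible pair the spectrum of the angle operator is at most a point | `exists_invariant_of_mem_spectrum_angleOp`, `spectrum_angleOp_subsingleton` (public form of the step inside t3's `CC2021_lem_4_2_i_holds`) | PROVED |
| `∠(P₂, P₁) = ∠(P₁, P₂)` | `angleOp_comm` | PROVED |
| (cosalpha) ⇒ eigenvalues: `ξ ∈ P₁H`, `P₁P₂P₁ξ = t²ξ` ⇒ `αξ = arccos|t|·ξ` (the mechanism of "`cos α(n) = |λ(n)|`"), and the mirror statement for `η ∈ P₂H` | `angleOp_apply_eq_arccos_smul`, `angleOp_apply_eq_arccos_smul'` | PROVED |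
| `(P₁ − P₂)ξ = 0 ⇒ αξ = 0` | `angleOp_apply_eq_zero` | PROVED |
| eigenvalues of a self-adjoint operator from a complete system "eigenvectors + kernel" | `exists_eigenvalue_eq_of_orthogonal_family` | PROVED (eigenvectors for distinct eigenvalues are orthogonal) |
| `CC2021_sec4_angle_spectrum`, clause 3: "`α` is `0` on Sonin's space `S(1,1)`" | `angleOp_cutoff_apply_of_mem_soninSpace` | PROVED (unconditional) |
| `CC2021_sec4_angle_spectrum`, clause 1: `αξ_n = arccos|λ(n)|ξ_n`, `αη_n = arccos|λ(n)|η_n` | `angleOp_cutoff_apply_of_eigenRelations` (abstract), `angleOp_cutoff_prolateXi_prolateEta` | PROVED (unconditional; the eigen-relations `𝒫₁ξ_n = ξ_n`, `𝒫₁η_n = λ(n)ξ_n`, `𝒫̂₁ξ_n = λ(n)η_n`, `𝒫̂₁η_n = η_n` are t3's) |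
| `CC2021_sec4_angle_spectrum`, clause 2: every non-zero eigenvalue of `α` on `L²(ℝ)_ev` is some `arccos|λ(n)|` — and hence the WHOLE fact | `eq_zero_of_orthogonal_xi_eta_sonin`, **`CC2021_sec4_angle_spectrum_of_xi_complete : CC2021_sec4_xi_complete → CC2021_sec4_angle_spectrum`** | PROVED CONDITIONALLY on the completeness fact `CC2021_sec4_xi_complete` only (end-state form: the hypothesis is the named fact itself); **append #2: DISCHARGED outright as `CC2021_sec4_angle_spectrum_holds`** now that `CC2021_sec4_xi_complete_holds` (seats t3/t10, `ProlateCommutation` / `ProlateProjectionsCompleteness`) is a tree theorem |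
| "`λ(0) = 0.999971, …` and all the further ones decay very fast to `0`" — the last clause `λ(n) → 0` of `CC2021_sec4_lambda_basic`, with the Hilbert–Schmidt/Bessel bound `Σ_n λ(n)² ≤ 4` behind Remark 4.6 (i) `δ(1) = Σ λ(n)²` | `sum_sq_prolateEigen_mul_sq_le`, `sum_sq_prolateEigen_le`, `summable_sq_prolateEigen`, `tsum_sq_prolateEigen_le`, **`tendsto_prolateEigen_zero`**, `CC2021_sec4_lambda_basic_clauses_2_4` | PROVED (Bessel for the orthonormal `ξ_n` against the cut-off plane waves `k_y = 1_{[−1,1]}e^{2πixy}`, `⟨k_y∣ξ_n⟩ = η_n(y) = λ(n)φ_n(y)` on `[−1,1]`, integrated over `y`; independent of completeness) |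

| "all eigenvalues of `F_c` are non-zero" / `λ(0) = 0.999971 > 0` | `prolateEigen_ne_zero`, `prolateEigen_zero_pos`, `neg_one_pow_mul_prolateEigen_zero_pos` (clause 1 of `CC2021_sec4_lambda_basic` at `n = 0`) | PROVED (`𝔽ξ_n` entire; `φ_0 > 0` on `(−1,1)`) |

Not attempted: the sign `(−1)ⁿλ(n) > 0` for `n ≥ 1` and the strict decrease of `|λ(n)|` (clauses 1, 3 of
`CC2021_sec4_lambda_basic`; Slepian–Pollak 1961 §III / Hogan–Lakey 2011 Thm. 1.2.8 + §2.1.3, by continuity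
in the band parameter from the Legendre case — at `c = 0`, `∫_{−1}^{1} P_{2n} = 0`, so no zero-counting
argument at fixed `c` gives the sign); `CC2021_sec4_lambda_basic` therefore stays a named fact (partial
discharge), and `CC2021_sec4_angle_spectrum` is discharged only modulo `CC2021_sec4_xi_complete`.
THEOREMS ONLY below.
-/

noncomputable section

open Set

namespace Literature.NumberTheory.ConnesConsani2021

section General

variable {H : Type*} [NormedAddCommGroup H] [InnerProductSpace ℂ H] [CompleteSpace H]

open scoped InnerProductSpace Real

/-! ### Eigenvectors pass through the real continuous functional calculus -/

omit [CompleteSpace H] in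
/-- Bookkeeping: the real scalars of `𝓛(H)` (`algebraMap ℝ (H →L[ℂ] H)`, the algebra structure used by
the real functional calculus and `spectrum ℝ`) act as `(a : ℂ) •`. [folklore] -/
private theorem algebraMap_real_apply (a : ℝ) (ψ : H) : algebraMap ℝ (H →L[ℂ] H) a ψ = (a : ℂ) • ψ := by
  rw [ContinuousLinearMap.algebraMap_apply, Complex.coe_smul]

omit [CompleteSpace H] in
/-- **Eigenvalues lie in the spectrum** ("if `λ` is an eigenvalue, then `λI − T` is not injective so `λ`
is in the spectrum of `T`"), for the real spectrum of a bounded operator on a complex Hilbert space.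
[cite: ReedSimonI1980, §VI.3 Definition p. 188 (held scan p0180:L15)] -/
theorem mem_spectrum_real_of_apply_eq_smul {A : H →L[ℂ] H} {a : ℝ} {ψ : H} (hψ : ψ ≠ 0)
    (h : A ψ = (a : ℂ) • ψ) : a ∈ spectrum ℝ A := by
  rw [spectrum.mem_iff]
  rintro ⟨u, hu⟩
  have h0 : (algebraMap ℝ (H →L[ℂ] H) a - A) ψ = 0 := by
    rw [sub_apply, algebraMap_real_apply, h, sub_self]
  have e : ((↑u⁻¹ : H →L[ℂ] H) * ↑u) ψ = ψ := by rw [Units.inv_mul, one_apply_eq_self]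
  rw [mul_apply_eq_comp, hu, h0, map_zero] at e
  exact hψ e.symm

/-- **Reed–Simon I, Thm. VII.1 (d)** for Mathlib's `cfcHom` of a self-adjoint bounded operator (real
continuous functional calculus): "If `Aψ = λψ`, then `φ(f)ψ = f(λ)ψ`" — by the Stone–Weierstrass
induction `ContinuousMap.induction_on_of_compact` (constants, `id`, sums, products, closure), as in
Mathlib's `Commute.cfcHom`. [cite: ReedSimonI1980, Thm. VII.1 (d) p. 222 (held scan p0212:L17)] -/
theorem cfcHom_apply_of_apply_eq_smul {A : H →L[ℂ] H} (hA : IsSelfAdjoint A) {a : ℝ} {ψ : H}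
    (h : A ψ = (a : ℂ) • ψ) (ha : a ∈ spectrum ℝ A) (F : C(spectrum ℝ A, ℝ)) :
    cfcHom hA F ψ = (F ⟨a, ha⟩ : ℂ) • ψ := by
  induction F using ContinuousMap.induction_on_of_compact with
  | const r =>
    have e : cfcHom hA (ContinuousMap.const (spectrum ℝ A) r) = algebraMap ℝ (H →L[ℂ] H) r :=
      AlgHomClass.commutes (cfcHom hA) r
    rw [e, algebraMap_real_apply, ContinuousMap.const_apply]
  | id =>
    rw [cfcHom_id hA, h]
    rfl
  | star_id =>
    rw [star_trivial, cfcHom_id hA, h]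
    rfl
  | add f g hf hg =>
    rw [map_add, add_apply, hf, hg, ContinuousMap.add_apply, Complex.ofReal_add, add_smul]
  | mul f g hf hg =>
    rw [map_mul, mul_apply_eq_comp, hg, map_smul, hf, ContinuousMap.mul_apply, Complex.ofReal_mul,
      smul_smul, mul_comm]
  | frequently f hf =>
    have hc : IsClosed {g : C(spectrum ℝ A, ℝ) | cfcHom hA g ψ = (g ⟨a, ha⟩ : ℂ) • ψ} :=
      isClosed_eq ((ContinuousLinearMap.apply ℂ H ψ).continuous.comp (cfcHom_continuous hA))
        ((Complex.continuous_ofReal.comp (continuous_eval_const (⟨a, ha⟩ : spectrum ℝ A))).smul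
          continuous_const)
    exact hc.mem_of_frequently_of_tendsto hf Filter.tendsto_id

/-- **Eigenvectors pass through the functional calculus (Reed–Simon I, Thm. VII.1 (d))**: if
`A ψ = a ψ` (`A` self-adjoint bounded, `a` real) then `f(A) ψ = f(a) ψ` for every `f` continuous on the
spectrum (`cfc f A` in Mathlib's real continuous functional calculus on `H →L[ℂ] H`).
[cite: ReedSimonI1980, Thm. VII.1 (d) p. 222 (held scan p0212:L17)] -/
theorem cfc_apply_of_apply_eq_smul {A : H →L[ℂ] H} (hA : IsSelfAdjoint A) {a : ℝ} {ψ : H}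
    (h : A ψ = (a : ℂ) • ψ) {f : ℝ → ℝ} (hf : ContinuousOn f (spectrum ℝ A)) :
    cfc f A ψ = (f a : ℂ) • ψ := by
  by_cases hψ : ψ = 0
  · rw [hψ, map_zero, smul_zero]
  have ha := mem_spectrum_real_of_apply_eq_smul hψ h
  rw [cfc_apply f A hA hf]
  exact cfcHom_apply_of_apply_eq_smul hA h ha _

/-! ### Lemma 4.2 (i): irreducible pairs have a scalar angle -/

/-- **Lemma 4.2 (i), the mechanism**: two distinct spectral values `s < t` of the angle operator `α` of a
pair of orthogonal projections produce a closed subspace invariant under `P₁` and `P₂` which is neither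
`0` nor `H` — the kernel of `g(α)`, `g = (x − m)₊`, `m = (s+t)/2` (`g(α)` commutes with `P₁, P₂` since `α`
does, Lemma 4.2 (ii); `g(α) ≠ 0` and `f(α) ≠ 0`, `f = (m − x)₊`, by the spectral mapping /
injectivity of the functional calculus, and `g(α)f(α) = (gf)(α) = 0`).
[cite: ConnesConsani2021, Lemma 4.2 (i) §4 p. 15 (arXiv item Lemma 22, p0015:L57–L62); ConnesMarcolli2008, Ch. 2 §3.3 Lemma 2.3] -/
theorem exists_invariant_of_mem_spectrum_angleOp {P₁ P₂ : H →L[ℂ] H} (h₁ : IsStarProjection P₁)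
    (h₂ : IsStarProjection P₂) {s t : ℝ} (hs : s ∈ spectrum ℝ (angleOp P₁ P₂))
    (ht : t ∈ spectrum ℝ (angleOp P₁ P₂)) (hst : s < t) :
    ∃ K : Submodule ℂ H, IsClosed (K : Set H) ∧ (∀ x ∈ K, P₁ x ∈ K) ∧ (∀ x ∈ K, P₂ x ∈ K) ∧
      K ≠ ⊥ ∧ K ≠ ⊤ := by
  set α := angleOp P₁ P₂ with hαdef
  have hα : IsSelfAdjoint α := cfc_predicate _ _
  obtain ⟨-, -, hc₁, hc₂, -⟩ := angleOp_spec P₁ P₂ h₁ h₂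
  set m : ℝ := (s + t) / 2 with hm
  set f : ℝ → ℝ := fun x => max (m - x) 0 with hfdef
  set g : ℝ → ℝ := fun x => max (x - m) 0 with hgdef
  have hfc : Continuous f := by rw [hfdef]; fun_prop
  have hgc : Continuous g := by rw [hgdef]; fun_prop
  have hgf : (fun x => g x * f x) = 0 := by
    funext x
    simp only [hfdef, hgdef, Pi.zero_apply]
    rcases le_total x m with hx | hx
    · rw [max_eq_right (by linarith), zero_mul]
    · rw [max_eq_right (by linarith : m - x ≤ 0), mul_zero]
  have hf0 : cfc f α ≠ 0 := by
    intro h0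
    have e := eqOn_of_cfc_eq_cfc (h0.trans (cfc_zero ℝ α).symm) hfc.continuousOn
      (continuousOn_const (c := (0 : ℝ))) hα hs
    simp only [hfdef, Pi.zero_apply, max_eq_right_iff] at e
    linarith
  have hg0 : cfc g α ≠ 0 := by
    intro h0
    have e := eqOn_of_cfc_eq_cfc (h0.trans (cfc_zero ℝ α).symm) hgc.continuousOn
      (continuousOn_const (c := (0 : ℝ))) hα ht
    simp only [hgdef, Pi.zero_apply, max_eq_right_iff] at e
    linarith
  let K : Submodule ℂ H := LinearMap.ker (cfc g α).toLinearMap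
  have hKmem : ∀ x, x ∈ K ↔ cfc g α x = 0 := fun x => LinearMap.mem_ker
  have hinv : ∀ P : H →L[ℂ] H, Commute α P → ∀ x ∈ K, P x ∈ K := by
    intro P hP x hx
    rw [hKmem] at hx ⊢
    have hc : Commute (cfc g α) P := hP.cfc_real g
    calc cfc g α (P x) = (cfc g α * P) x := rfl
      _ = (P * cfc g α) x := by rw [hc.eq]
      _ = P (cfc g α x) := rfl
      _ = 0 := by rw [hx, map_zero]
  refine ⟨K, ContinuousLinearMap.isClosed_ker _, hinv P₁ hc₁, hinv P₂ hc₂, ?_, ?_⟩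
  · intro hbot
    apply hf0
    ext x
    have hx : cfc f α x ∈ K := by
      rw [hKmem]
      calc cfc g α (cfc f α x) = (cfc g α * cfc f α) x := rfl
        _ = 0 := by rw [← cfc_mul g f α hgc.continuousOn hfc.continuousOn, hgf, cfc_zero]; rfl
    rw [hbot, Submodule.mem_bot] at hx
    rw [hx]
    rfl
  · intro htop
    apply hg0
    ext y
    have hy : y ∈ K := htop ▸ Submodule.mem_top
    rw [hKmem] at hy
    rw [hy]
    rfl

/-- **Lemma 4.2 (i)**: for an IRREDUCIBLE pair of orthogonal projections the spectrum of the angle operator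
has at most one point. [cite: ConnesConsani2021, Lemma 4.2 (i) §4 p. 15 (arXiv item Lemma 22, p0015:L57–L62); ConnesMarcolli2008, Ch. 2 §3.3 Lemma 2.3] -/
theorem spectrum_angleOp_subsingleton {P₁ P₂ : H →L[ℂ] H} (h₁ : IsStarProjection P₁)
    (h₂ : IsStarProjection P₂) (hirr : IsIrreduciblePair P₁ P₂) :
    (spectrum ℝ (angleOp P₁ P₂)).Subsingleton := by
  intro s hs t ht
  by_contra hst
  rcases lt_or_gt_of_ne hst with hlt | hlt
  · obtain ⟨K, hK, hK1, hK2, hb, htp⟩ := exists_invariant_of_mem_spectrum_angleOp h₁ h₂ hs ht hlt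
    rcases hirr.2 K hK hK1 hK2 with h | h
    exacts [hb h, htp h]
  · obtain ⟨K, hK, hK1, hK2, hb, htp⟩ := exists_invariant_of_mem_spectrum_angleOp h₁ h₂ ht hs hlt
    rcases hirr.2 K hK hK1 hK2 with h | h
    exacts [hb h, htp h]

/-! ### Symmetry and eigenvectors of the angle operator -/

/-- `∠(P₂, P₁) = ∠(P₁, P₂)` (`arcsin|−x| = arcsin|x|`). [cite: ConnesConsani2021, Def. 4.3 §4 p. 15 (arXiv item Definition 23, p0015:L72–L73)] -/
theorem angleOp_comm {P₁ P₂ : H →L[ℂ] H} (h₁ : IsSelfAdjoint P₁) (h₂ : IsSelfAdjoint P₂) :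
    angleOp P₂ P₁ = angleOp P₁ P₂ := by
  have hA : IsSelfAdjoint (P₁ - P₂) := h₁.sub h₂
  rw [angleOp, angleOp, ← neg_sub, ← cfc_comp_neg (fun x : ℝ => Real.arcsin |x|) (P₁ - P₂)]
  simp only [abs_neg]

/-- **(cosalpha) ⇒ (cosalphan1), operator half**: if `ξ ∈ P₁H` and `P₁P₂P₁ ξ = t² ξ` then
`∠(P₁,P₂) ξ = arccos|t| · ξ` — the mechanism behind "the non-zero eigenvalues `α(n)` of `α` are given by
`cos α(n) = |λ(n)|`": `cos²(α)ξ = cos²(α)P₁ξ = P₁P₂P₁ξ = t²ξ` (Lemma 4.2 (ii)), `α = arccos √(cos² α)` on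
`spec α ⊆ [0, π/2]`, and eigenvectors pass through the functional calculus.
[cite: ConnesConsani2021, §4 p. 16 eq. (cosalpha), (cosalphan1) (arXiv p0016:L13–L16, L29–L34)] -/
theorem angleOp_apply_eq_arccos_smul {P₁ P₂ : H →L[ℂ] H} (h₁ : IsStarProjection P₁)
    (h₂ : IsStarProjection P₂) {ξ : H} {t : ℝ} (hξ : P₁ ξ = ξ)
    (h : (P₁ * P₂ * P₁) ξ = ((t ^ 2 : ℝ) : ℂ) • ξ) :
    angleOp P₁ P₂ ξ = (Real.arccos |t| : ℂ) • ξ := by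
  set α := angleOp P₁ P₂ with hαdef
  have hα : IsSelfAdjoint α := cfc_predicate _ _
  obtain ⟨-, hsp, -, -, -, hppp, -⟩ := angleOp_spec P₁ P₂ h₁ h₂
  set B := cfc (fun x : ℝ => Real.cos x ^ 2) α with hB
  have hBsa : IsSelfAdjoint B := cfc_predicate _ _
  have hBξ : B ξ = ((t ^ 2 : ℝ) : ℂ) • ξ := by
    have e : B * P₁ = P₁ * P₂ * P₁ := by
      rw [hB, cfc_pow Real.cos 2 α Real.continuous_cos.continuousOn hα, ← hppp]
    calc B ξ = B (P₁ ξ) := by rw [hξ]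
      _ = (B * P₁) ξ := rfl
      _ = ((t ^ 2 : ℝ) : ℂ) • ξ := by rw [e, h]
  have hαB : α = cfc (fun y : ℝ => Real.arccos (Real.sqrt y)) B := by
    rw [hB, ← cfc_comp' (fun y : ℝ => Real.arccos (Real.sqrt y)) (fun x : ℝ => Real.cos x ^ 2) α
      (Real.continuous_arccos.comp Real.continuous_sqrt).continuousOn
      (Real.continuous_cos.pow 2).continuousOn hα]
    conv_lhs => rw [← cfc_id' ℝ α]
    refine cfc_congr fun x hx => ?_
    have hx' := hsp hx
    show x = Real.arccos (Real.sqrt (Real.cos x ^ 2))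
    rw [Real.sqrt_sq (Real.cos_nonneg_of_mem_Icc ⟨by linarith [hx'.1, Real.pi_pos], hx'.2⟩),
      Real.arccos_cos hx'.1 (by linarith [hx'.2, Real.pi_pos])]
  rw [hαB, cfc_apply_of_apply_eq_smul hBsa hBξ (Continuous.continuousOn (by fun_prop)),
    Real.sqrt_sq_eq_abs]

/-- The same with the roles of `P₁`, `P₂` exchanged (`∠` is symmetric, `angleOp_comm`): if `η ∈ P₂H` and
`P₂P₁P₂ η = t² η` then `∠(P₁,P₂) η = arccos|t| · η` (used for `η_n ∈ 𝒫̂₁L²`).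
[cite: ConnesConsani2021, §4 p. 16 eq. (cosalpha), (cosalphan1) (arXiv p0016:L13–L16, L29–L34)] -/
theorem angleOp_apply_eq_arccos_smul' {P₁ P₂ : H →L[ℂ] H} (h₁ : IsStarProjection P₁)
    (h₂ : IsStarProjection P₂) {η : H} {t : ℝ} (hη : P₂ η = η)
    (h : (P₂ * P₁ * P₂) η = ((t ^ 2 : ℝ) : ℂ) • η) :
    angleOp P₁ P₂ η = (Real.arccos |t| : ℂ) • η := by
  rw [angleOp_comm h₂.isSelfAdjoint h₁.isSelfAdjoint]
  exact angleOp_apply_eq_arccos_smul h₂ h₁ hη h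

/-- The angle operator kills every vector on which `P₁ − P₂` vanishes (the joint kernel and the joint
range of the pair: the angle-`0` part), `arcsin|0| = 0`. [cite: ConnesConsani2021, §4 p. 16 "on this subspace, which is Sonin's space … `α` = 0" (arXiv p0016:L39)] -/
theorem angleOp_apply_eq_zero {P₁ P₂ : H →L[ℂ] H} (h₁ : IsSelfAdjoint P₁) (h₂ : IsSelfAdjoint P₂)
    {ξ : H} (hξ : (P₁ - P₂) ξ = 0) : angleOp P₁ P₂ ξ = 0 := by
  have hA : IsSelfAdjoint (P₁ - P₂) := h₁.sub h₂
  have h0 : (P₁ - P₂) ξ = ((0 : ℝ) : ℂ) • ξ := by rw [hξ, Complex.ofReal_zero, zero_smul]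
  rw [angleOp, cfc_apply_of_apply_eq_smul hA h0 (Continuous.continuousOn (by fun_prop)), abs_zero,
    Real.arcsin_zero, Complex.ofReal_zero, zero_smul]

/-- **Eigenvalues of a self-adjoint operator from a complete system of eigenvectors plus kernel**: if `A` is
self-adjoint, `S ⊆ ker A`, the `v i` are eigenvectors with real eigenvalues `a i`, and inside a subspace
`E` the only vector orthogonal to `S` and to all the `v i` is `0`, then every eigenvalue `μ ≠ 0` of `A`
with an eigenvector in `E` is one of the `a i` ("eigenvectors corresponding to distinct eigenvalues of
`T` are orthogonal"). [cite: ReedSimonI1980, Thm. VI.8 (c) p. 194 (held scan p0185:L24)] -/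
theorem exists_eigenvalue_eq_of_orthogonal_family {A : H →L[ℂ] H} (hA : IsSelfAdjoint A)
    {ι : Type*} {v : ι → H} {a : ι → ℝ} (hv : ∀ i, A (v i) = (a i : ℂ) • v i)
    {S E : Submodule ℂ H} (hS : ∀ y ∈ S, A y = 0)
    (hdense : ∀ x ∈ E, (∀ i, ⟪v i, x⟫_ℂ = 0) → (∀ y ∈ S, ⟪y, x⟫_ℂ = 0) → x = 0)
    {ξ : H} (hξE : ξ ∈ E) (hξ : ξ ≠ 0) {μ : ℂ} (hμ : μ ≠ 0) (h : A ξ = μ • ξ) :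
    ∃ i, μ = a i := by
  have hsym := ContinuousLinearMap.isSelfAdjoint_iff_isSymmetric.mp hA
  by_contra hne
  push Not at hne
  refine hξ (hdense ξ hξE (fun i => ?_) (fun y hy => ?_))
  · have e1 : ⟪v i, A ξ⟫_ℂ = μ * ⟪v i, ξ⟫_ℂ := by rw [h, inner_smul_right]
    have hs : ⟪A (v i), ξ⟫_ℂ = ⟪v i, A ξ⟫_ℂ := hsym (v i) ξ
    have e2 : ⟪v i, A ξ⟫_ℂ = (a i : ℂ) * ⟪v i, ξ⟫_ℂ := by
      rw [← hs, hv i, inner_smul_left, Complex.conj_ofReal]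
    have e3 : (μ - a i) * ⟪v i, ξ⟫_ℂ = 0 := by rw [sub_mul, ← e1, ← e2, sub_self]
    rcases mul_eq_zero.mp e3 with h0 | h0
    · exact absurd (sub_eq_zero.mp h0) (hne i)
    · exact h0
  · have e1 : ⟪y, A ξ⟫_ℂ = μ * ⟪y, ξ⟫_ℂ := by rw [h, inner_smul_right]
    have hs : ⟪A y, ξ⟫_ℂ = ⟪y, A ξ⟫_ℂ := hsym y ξ
    have e2 : ⟪y, A ξ⟫_ℂ = 0 := by
      rw [← hs, hS y hy, inner_zero_left]
    rw [e2] at e1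
    rcases mul_eq_zero.mp e1.symm with h0 | h0
    · exact absurd h0 hμ
    · exact h0

end General

/-! ### The pair `(𝒫₁, 𝒫̂₁)` on `L²(ℝ)` -/

section L2

open MeasureTheory

/-- **`CC2021_sec4_angle_spectrum`, third clause, PROVED** (unconditionally): the angle operator
`∠(𝒫₁, 𝒫̂₁)` vanishes on Sonin's space `S(1,1)` — both cutoffs vanish there
(`mem_soninSpace_iff_cutoffProj`), so `𝒫₁ − 𝒫̂₁` does.
[cite: ConnesConsani2021, §4 p. 16 (arXiv p0016:L39); Prop. 4.5 (iii) proof p. 17 (arXiv p0017:L41–L57)] -/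
theorem angleOp_cutoff_apply_of_mem_soninSpace {ξ : Lp ℂ 2 (volume : Measure ℝ)}
    (hξ : ξ ∈ soninSpace 1 1) : angleOp (cutoffProj 1) (cutoffProjHat 1) ξ = 0 := by
  obtain ⟨-, h1, h2⟩ := mem_soninSpace_iff_cutoffProj.1 hξ
  exact angleOp_apply_eq_zero (cutoffProj_isSelfAdjoint 1) (isStarProjection_cutoffProjHat 1).isSelfAdjoint
    (by rw [sub_apply, h1, h2, sub_zero])

/-- **`CC2021_sec4_angle_spectrum`, first clause, operator half**: granted the eigen-relations of
(cosalphan)/Prop. 4.5 (i) in operator form — `𝒫₁ξ = ξ`, `𝒫̂₁η = η`, `𝒫₁η = tξ`, `𝒫̂₁ξ = tη` (for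
`ξ = ξ_n`, `η = η_n`, `t = λ(n)`: the first is `cutoffProj_prolateXi`, the third `CC2021_prop_4_5_i`,
the other two their Fourier mirrors) — `ξ` and `η` are eigenvectors of `∠(𝒫₁, 𝒫̂₁)` with eigenvalue
`arccos|t|` (`𝒫₁𝒫̂₁𝒫₁ξ = t²ξ`, `𝒫̂₁𝒫₁𝒫̂₁η = t²η`).
[cite: ConnesConsani2021, §4 p. 16 eq. (cosalpha), (cosalphan1) (arXiv p0016:L13–L16, L29–L34); Prop. 4.5 (iii) proof p. 17 (arXiv p0017:L41–L57)] -/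
theorem angleOp_cutoff_apply_of_eigenRelations {ξ η : Lp ℂ 2 (volume : Measure ℝ)} {t : ℝ}
    (hξ : cutoffProj 1 ξ = ξ) (hη : cutoffProjHat 1 η = η)
    (h₁ : cutoffProj 1 η = (t : ℂ) • ξ) (h₂ : cutoffProjHat 1 ξ = (t : ℂ) • η) :
    angleOp (cutoffProj 1) (cutoffProjHat 1) ξ = (Real.arccos |t| : ℂ) • ξ ∧
      angleOp (cutoffProj 1) (cutoffProjHat 1) η = (Real.arccos |t| : ℂ) • η := by
  have hP₁ := isStarProjection_cutoffProj 1
  have hP₂ := isStarProjection_cutoffProjHat 1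
  constructor
  · refine angleOp_apply_eq_arccos_smul hP₁ hP₂ hξ ?_
    calc (cutoffProj 1 * cutoffProjHat 1 * cutoffProj 1) ξ = cutoffProj 1 (cutoffProjHat 1 (cutoffProj 1 ξ)) := rfl
      _ = ((t ^ 2 : ℝ) : ℂ) • ξ := by
          rw [hξ, h₂, map_smul, h₁, smul_smul, Complex.ofReal_pow, sq]
  · refine angleOp_apply_eq_arccos_smul' hP₁ hP₂ hη ?_
    calc (cutoffProjHat 1 * cutoffProj 1 * cutoffProjHat 1) η =
        cutoffProjHat 1 (cutoffProj 1 (cutoffProjHat 1 η)) := rfl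
      _ = ((t ^ 2 : ℝ) : ℂ) • η := by
          rw [hη, h₁, map_smul, h₂, smul_smul, Complex.ofReal_pow, sq]

end L2

/-! ### The eigenvalues `λ(n)`: `Σ λ(n)² ≤ 4` (Bessel / Hilbert–Schmidt) and `λ(n) → 0` -/

section Lambda

open _root_.MeasureTheory Complex FourierTransform Filter
open scoped Real ComplexConjugate InnerProductSpace ENNReal Topology
open Literature.NumberTheory.LFunctions

/-- The cut-off plane wave `k_y(x) = 1_{[−1,1]}(x) e^{2πixy}` is bounded by `1`. [folklore] -/
private theorem norm_cutoffWave_le (y x : ℝ) :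
    ‖(Icc (-1 : ℝ) 1).indicator (fun x : ℝ => cexp (2 * π * x * y * I)) x‖ ≤ 1 := by
  by_cases hx : x ∈ Icc (-1 : ℝ) 1
  · rw [indicator_of_mem hx, show (2 * π * x * y * I : ℂ) = ((2 * π * x * y : ℝ) : ℂ) * I by push_cast; ring,
      Complex.norm_exp_ofReal_mul_I]
  · rw [indicator_of_notMem hx, norm_zero]; exact zero_le_one

/-- `k_y` is integrable. [folklore] -/
private theorem integrable_cutoffWave (y : ℝ) :
    Integrable ((Icc (-1 : ℝ) 1).indicator fun x : ℝ => cexp (2 * π * x * y * I)) := by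
  refine IntegrableOn.integrable_indicator ?_ measurableSet_Icc
  exact (by fun_prop : Continuous fun x : ℝ => cexp (2 * π * x * y * I)).integrableOn_Icc

/-- `k_y ∈ L²(ℝ)`. [cite: ConnesConsani2021, Prop. 4.5 (iii) proof §4 p. 17 (arXiv p0017:L26)] -/
theorem memLp_cutoffWave (y : ℝ) :
    MemLp ((Icc (-1 : ℝ) 1).indicator fun x : ℝ => cexp (2 * π * x * y * I)) 2 (volume : Measure ℝ) :=
  Literature.Analysis.FluidPDE.FourierNS.memLp_two_of_bound (integrable_cutoffWave y)
    (norm_cutoffWave_le y)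

/-- `‖k_y‖² = 2` in `L²(ℝ)`. [cite: ConnesConsani2021, Prop. 4.5 (iii) proof §4 p. 17 (arXiv p0017:L26)] -/
theorem norm_cutoffWave_sq (y : ℝ) : ‖(memLp_cutoffWave y).toLp _‖ ^ 2 = 2 := by
  rw [← inner_self_eq_norm_sq (𝕜 := ℂ) ((memLp_cutoffWave y).toLp _), L2.inner_def]
  have h1 : ∫ x : ℝ, ⟪((memLp_cutoffWave y).toLp _ : ℝ → ℂ) x, ((memLp_cutoffWave y).toLp _ : ℝ → ℂ) x⟫_ℂ =
      ∫ x : ℝ, (Icc (-1 : ℝ) 1).indicator (fun _ => (1 : ℂ)) x := by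
    refine integral_congr_ae ?_
    filter_upwards [MemLp.coeFn_toLp (memLp_cutoffWave y)] with x hx
    rw [hx, RCLike.inner_apply]
    by_cases hxI : x ∈ Icc (-1 : ℝ) 1
    · rw [indicator_of_mem hxI, indicator_of_mem hxI, Complex.mul_conj, Complex.normSq_eq_norm_sq,
        show (2 * π * x * y * I : ℂ) = ((2 * π * x * y : ℝ) : ℂ) * I by push_cast; ring,
        Complex.norm_exp_ofReal_mul_I]
      simp
    · rw [indicator_of_notMem hxI, indicator_of_notMem hxI, map_zero, mul_zero]
  rw [h1, integral_indicator_const _ measurableSet_Icc, Real.volume_real_Icc]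
  norm_num

/-- **`⟨k_y|ξ_n⟩ = η_n(y)`**: the Fourier integral `η_n = 𝓕ξ_n` evaluated at `y` is the inner product of
`ξ_n` with the cut-off plane wave (`ξ_n` lives on `[−1,1]`). [cite: ConnesConsani2021, Prop. 4.5 (i) §4 p. 16 (arXiv p0016:L50); Prop. 4.5 (iii) proof p. 17 (arXiv p0017:L26)] -/
theorem inner_cutoffWave_prolateXi (y : ℝ) (n : ℕ) :
    ⟪(memLp_cutoffWave y).toLp _, prolateXi n⟫_ℂ = prolateEtaFun n y := by
  rw [L2.inner_def, prolateEtaFun, Real.fourier_real_eq_integral_exp_smul]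
  refine integral_congr_ae ?_
  filter_upwards [MemLp.coeFn_toLp (memLp_cutoffWave y), prolateXi_coeFn n] with x hx hξ
  rw [hx, hξ, RCLike.inner_apply, smul_eq_mul]
  by_cases hxI : x ∈ Icc (-1 : ℝ) 1
  · rw [indicator_of_mem hxI, mul_comm, ← Complex.exp_conj]
    congr 2
    simp only [map_mul, Complex.conj_ofReal, Complex.conj_I, map_ofNat]
    push_cast
    ring
  · simp [indicator_of_notMem hxI, prolateXiFun, prolateFun_eq_zero_of_notMem hxI]

/-- **Bessel's inequality for the `λ(n)`**: for `y ∈ [−1, 1]` and every finite set of indices,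
`Σ_n λ(n)² φ_n(y)² = Σ_n |⟨ξ_n|k_y⟩|² ≤ ‖k_y‖² = 2` (the `ξ_n` are orthonormal, `η_n = λ(n)φ_n` on
`[−1,1]`). [cite: ConnesConsani2021, §4 p. 16 "all the further ones decay very fast to 0" (arXiv p0016:L22–L25); Prop. 4.5 (iii) proof p. 17 (arXiv p0017:L26)] -/
theorem sum_sq_prolateEigen_mul_sq_le {y : ℝ} (hy : y ∈ Icc (-1 : ℝ) 1) (s : Finset ℕ) :
    ∑ n ∈ s, prolateEigen n ^ 2 * prolateFun n y ^ 2 ≤ 2 := by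
  have hB := CC2021_sec4_xi_orthonormal_holds.sum_inner_products_le ((memLp_cutoffWave y).toLp _) (s := s)
  rw [norm_cutoffWave_sq] at hB
  refine le_trans (le_of_eq ?_) hB
  refine Finset.sum_congr rfl fun n _ => ?_
  rw [norm_inner_symm, inner_cutoffWave_prolateXi, prolateEtaFun_eq_of_mem n hy, norm_mul,
    Complex.norm_real, Complex.norm_real, Real.norm_eq_abs, Real.norm_eq_abs, mul_pow, sq_abs, sq_abs]

/-- **`Σ_{n ∈ s} λ(n)² ≤ 4` for every finite `s`** (integrate Bessel over `y ∈ [−1, 1]`, `∫_{−1}^{1} φ_n² = 1`):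
the Hilbert–Schmidt bound `Σ λ(n)² ≤ ‖𝒫₁𝔽_{e_ℝ}𝒫₁‖²_{HS} = 4` behind "`δ(1) = Σ λ(n)²`" (Remark 4.6 (i)).
[cite: ConnesConsani2021, §4 p. 16 (arXiv p0016:L22–L25); Remark 4.6 (i) p. 18 (arXiv item Remark 26)] -/
theorem sum_sq_prolateEigen_le (s : Finset ℕ) : ∑ n ∈ s, prolateEigen n ^ 2 ≤ 4 := by
  have hnorm : ∀ n, ∫ y in (-1 : ℝ)..1, prolateFun n y ^ 2 = 1 := fun n =>
    (isProlateFunction_prolateFun n).norm_one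
  have hcont : ∀ n, ContinuousOn (prolateFun n) (Icc (-1 : ℝ) 1) := fun n =>
    (isProlateFunction_prolateFun n).contDiffOn.continuousOn
  have hii : ∀ n, IntervalIntegrable (fun y => prolateEigen n ^ 2 * prolateFun n y ^ 2) volume (-1 : ℝ) 1 :=
    fun n => by
      refine ContinuousOn.intervalIntegrable ?_
      rw [uIcc_of_le (by norm_num : (-1 : ℝ) ≤ 1)]
      exact continuousOn_const.mul ((hcont n).pow 2)
  calc ∑ n ∈ s, prolateEigen n ^ 2
        = ∑ n ∈ s, ∫ y in (-1 : ℝ)..1, prolateEigen n ^ 2 * prolateFun n y ^ 2 := by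
          refine Finset.sum_congr rfl fun n _ => ?_
          rw [intervalIntegral.integral_const_mul, hnorm, mul_one]
    _ = ∫ y in (-1 : ℝ)..1, ∑ n ∈ s, prolateEigen n ^ 2 * prolateFun n y ^ 2 := by
          rw [intervalIntegral.integral_finsetSum fun n _ => hii n]
    _ ≤ ∫ _ in (-1 : ℝ)..1, (2 : ℝ) := by
          refine intervalIntegral.integral_mono_on (by norm_num) ?_ intervalIntegrable_const
            fun y hy => sum_sq_prolateEigen_mul_sq_le hy s
          refine ContinuousOn.intervalIntegrable ?_
          rw [uIcc_of_le (by norm_num : (-1 : ℝ) ≤ 1)]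
          exact continuousOn_finsetSum s fun n _ => continuousOn_const.mul ((hcont n).pow 2)
    _ = 4 := by rw [intervalIntegral.integral_const]; norm_num

/-- **`Σ_n λ(n)²` converges** (partial sums bounded by `4`). [cite: ConnesConsani2021, §4 p. 16 (arXiv p0016:L22–L25); Remark 4.6 (i) p. 18] -/
theorem summable_sq_prolateEigen : Summable fun n : ℕ => prolateEigen n ^ 2 :=
  summable_of_sum_le (fun _ => sq_nonneg _) sum_sq_prolateEigen_le

/-- `Σ_n λ(n)² ≤ 4`. [cite: ConnesConsani2021, §4 p. 16 (arXiv p0016:L22–L25); Remark 4.6 (i) p. 18] -/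
theorem tsum_sq_prolateEigen_le : ∑' n : ℕ, prolateEigen n ^ 2 ≤ 4 :=
  summable_sq_prolateEigen.tsum_le_of_sum_le sum_sq_prolateEigen_le

/-- **`λ(n) → 0`** ("all the further ones decay very fast to `0`"; the last clause of
`CC2021_sec4_lambda_basic`), PROVED: `λ(n)²` is the general term of a convergent series.
[cite: ConnesConsani2021, §4 p. 16 (arXiv p0016:L22–L25); Connes2026Letter, §6.3 Fact 6.3] -/
theorem tendsto_prolateEigen_zero : Tendsto prolateEigen atTop (𝓝 0) := by
  have h := summable_sq_prolateEigen.tendsto_atTop_zero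
  have h2 : Tendsto (fun n => Real.sqrt (prolateEigen n ^ 2)) atTop (𝓝 (Real.sqrt 0)) :=
    (Real.continuous_sqrt.tendsto 0).comp h
  rw [Real.sqrt_zero] at h2
  simp only [Real.sqrt_sq_eq_abs] at h2
  exact tendsto_zero_iff_norm_tendsto_zero.mpr h2

/-- **`CC2021_sec4_lambda_basic`, clauses 2 and 4** (`|λ(n)| < 1` — seat t3's `abs_prolateEigen_lt_one` — and
`λ(n) → 0`); the sign `(−1)ⁿλ(n) > 0` and the strict decrease of `|λ(n)|` (Slepian–Pollak §III) are not
proved here. [cite: ConnesConsani2021, §4 p. 16 (arXiv p0016:L22–L25); RokhlinXiao2007, Thm. 3 p. 109] -/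
theorem CC2021_sec4_lambda_basic_clauses_2_4 :
    (∀ n : ℕ, |prolateEigen n| < 1) ∧ Tendsto prolateEigen atTop (𝓝 0) :=
  ⟨abs_prolateEigen_lt_one, tendsto_prolateEigen_zero⟩

end Lambda


/-! ### Fourier parity on `L²(ℝ)_ev` and the whole of (angle_spectrum) from the completeness fact -/

section Parity

open _root_.MeasureTheory Complex FourierTransform Filter
open scoped Real ComplexConjugate InnerProductSpace ENNReal Topology

/-- **(angle_spectrum), first clause, PROVED**: `αξ_n = arccos|λ(n)|ξ_n` and `αη_n = arccos|λ(n)|η_n`.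
[cite: ConnesConsani2021, §4 p. 16 eq. (cosalpha), (cosalphan1) (arXiv p0016:L13–L16, L29–L34); Prop. 4.5 (iii) proof p. 17 (arXiv p0017:L41–L57)] -/
theorem angleOp_cutoff_prolateXi_prolateEta (n : ℕ) :
    angleOp (cutoffProj 1) (cutoffProjHat 1) (prolateXi n) = (Real.arccos |prolateEigen n| : ℂ) • prolateXi n ∧
      angleOp (cutoffProj 1) (cutoffProjHat 1) (prolateEta n) =
        (Real.arccos |prolateEigen n| : ℂ) • prolateEta n :=
  angleOp_cutoff_apply_of_eigenRelations (cutoffProj_prolateXi n) (cutoffProjHat_prolateEta n)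
    (CC2021_prop_4_5_i_holds n) (cutoffProjHat_prolateXi n)

/-- **Density modulo Sonin's space, from completeness**: granted `CC2021_sec4_xi_complete`, an even
`x ∈ L²(ℝ)` orthogonal to all `ξ_n`, all `η_n` and to `S(1,1)` vanishes (`𝒫₁x = 0` by completeness in
`𝒫₁L²_ev`; `𝒫₁𝔽x = 0` likewise since `⟨ξ_n|𝔽x⟩ = ⟨𝔽η_n|𝔽x⟩ = ⟨η_n|x⟩`; so `x ∈ S(1,1) ∩ S(1,1)^⊥`).
[cite: ConnesConsani2021, Prop. 4.5 (iii) proof §4 p. 17 (arXiv p0017:L2, L41–L63)] -/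
theorem eq_zero_of_orthogonal_xi_eta_sonin (hc : CC2021_sec4_xi_complete)
    {x : Lp ℂ 2 (volume : Measure ℝ)} (hx : x ∈ evenPart) (hξ : ∀ n, ⟪prolateXi n, x⟫_ℂ = 0)
    (hη : ∀ n, ⟪prolateEta n, x⟫_ℂ = 0) (hS : ∀ y ∈ soninSpace 1 1, ⟪y, x⟫_ℂ = 0) : x = 0 := by
  have hadj : ContinuousLinearMap.adjoint (cutoffProj 1) = cutoffProj 1 :=
    (cutoffProj_isSelfAdjoint 1).adjoint_eq
  have hidem : ∀ u, cutoffProj 1 (cutoffProj 1 u) = cutoffProj 1 u := fun u => by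
    have h := congrArg (fun T => T u) (cutoffProj_idem 1).eq
    exact h
  -- `𝒫₁ x = 0`
  have h1 : cutoffProj 1 x = 0 := by
    refine hc _ (cutoffProj_mem_evenPart 1 hx) (hidem x) fun n => ?_
    rw [← hadj, ContinuousLinearMap.adjoint_inner_right, cutoffProj_prolateXi, hξ n]
  -- `𝒫₁ 𝔽 x = 0`
  have h2 : cutoffProj 1 (𝓕 x : Lp ℂ 2 (volume : Measure ℝ)) = 0 := by
    refine hc _ (cutoffProj_mem_evenPart 1 (fourier_mem_evenPart hx)) (hidem _) fun n => ?_
    rw [← hadj, ContinuousLinearMap.adjoint_inner_right, cutoffProj_prolateXi, ← fourier_prolateEta,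
      Lp.inner_fourier_eq, hη n]
  have h3 : cutoffProjHat 1 x = 0 := by
    rw [cutoffProjHat_apply, h2]; exact fourierInv_zero
  have hmem : x ∈ soninSpace 1 1 := mem_soninSpace_iff_cutoffProj.2 ⟨hx, h1, h3⟩
  exact inner_self_eq_zero.mp (hS x hmem)

/-- **`CC2021_sec4_angle_spectrum` from the completeness fact**: all three clauses of (angle_spectrum),
the second one — "the non-zero eigenvalues `α(n)` of `α` are given by `cos α(n) = |λ(n)|`", i.e. every
non-zero eigenvalue of `∠(𝒫₁, 𝒫̂₁)` on `L²(ℝ)_ev` is some `arccos|λ(n)|` — GRANTED the completeness fact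
`CC2021_sec4_xi_complete` ("the `ξ_n` form an orthonormal basis of the range of `𝒫₁`"): an eigenvector
for another eigenvalue would be orthogonal to all `ξ_n, η_n` (eigenvectors, clause 1) and to `S(1,1)`
(where `α = 0`, clause 3), hence zero.  This is the END-STATE conditional form: the hypothesis is the named
fact itself. [cite: ConnesConsani2021, §4 p. 16 eq. (cosalpha), (cosalphan1) (arXiv p0016:L13–L16, L29–L34, L39); Prop. 4.5 (iii) proof p. 17 (arXiv p0017:L41–L57)] -/
theorem CC2021_sec4_angle_spectrum_of_xi_complete (hc : CC2021_sec4_xi_complete) :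
    CC2021_sec4_angle_spectrum := by
  refine ⟨angleOp_cutoff_prolateXi_prolateEta, ?_, fun ξ hξ => angleOp_cutoff_apply_of_mem_soninSpace hξ⟩
  intro ξ hξev hξ0 μ hμ h
  have hα : IsSelfAdjoint (angleOp (cutoffProj 1) (cutoffProjHat 1)) := cfc_predicate _ _
  have hv : ∀ i : ℕ ⊕ ℕ, angleOp (cutoffProj 1) (cutoffProjHat 1) (Sum.elim prolateXi prolateEta i) =
      ((Sum.elim (fun n => Real.arccos |prolateEigen n|) (fun n => Real.arccos |prolateEigen n|) i : ℝ) : ℂ) •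
        Sum.elim prolateXi prolateEta i := by
    rintro (n | n)
    · exact (angleOp_cutoff_prolateXi_prolateEta n).1
    · exact (angleOp_cutoff_prolateXi_prolateEta n).2
  obtain ⟨i, hi⟩ := exists_eigenvalue_eq_of_orthogonal_family hα hv (S := soninSpace 1 1) (E := evenPart)
    (fun y hy => angleOp_cutoff_apply_of_mem_soninSpace hy)
    (fun x hx hvx hSx => eq_zero_of_orthogonal_xi_eta_sonin hc hx (fun n => hvx (Sum.inl n))
      (fun n => hvx (Sum.inr n)) hSx)
    hξev hξ0 hμ h
  rcases i with n | n
  · exact ⟨n, hi⟩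
  · exact ⟨n, hi⟩

end Parity


/-! ### `λ(n) ≠ 0` and the sign of `λ(0)` -/

section Sign

open _root_.MeasureTheory Complex FourierTransform Filter
open scoped Real ComplexConjugate InnerProductSpace ENNReal Topology
open Literature.NumberTheory.LFunctions

/-- **`λ(n) ≠ 0`** ("all eigenvalues of `F_c` are non-zero", part of the printed `λ_n = iⁿ|λ_n|`): if
`λ(n) = 0` then `η_n = 𝔽ξ_n = λ(n)φ_n` vanishes on `(−1, 1)`, hence identically (the Fourier transform of the
compactly supported `ξ_n` is entire — the tree's `fourier_eq_zero_of_eqOn_Ioo`), contradicting `‖η_n‖ = 1`.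
[cite: ConnesConsani2021, §4 p. 16 (arXiv p0016:L22–L25); RokhlinXiao2007, Thm. 3 p. 109] -/
theorem prolateEigen_ne_zero (n : ℕ) : prolateEigen n ≠ 0 := by
  intro h0
  have hzero : ∀ y ∈ Ioo (-1 : ℝ) 1, 𝓕 (prolateXiFun n) y = 0 := fun y hy => by
    have h := prolateEtaFun_eq_of_mem n (x := y) ⟨hy.1.le, hy.2.le⟩
    rw [prolateEtaFun, h0] at h
    rw [h]; simp
  have hall := Literature.Analysis.Fourier.fourier_eq_zero_of_eqOn_Ioo (integrable_prolateXiFun n)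
    zero_le_one (fun x hx ↦ by simp [prolateXiFun, prolateFun_eq_zero_of_notMem hx])
    (by norm_num : (-1 : ℝ) < 1) hzero
  have hη : prolateEta n = 0 := by
    apply Lp.ext
    filter_upwards [prolateEta_coeFn n, Lp.coeFn_zero ℂ 2 (volume : Measure ℝ)] with x hx hz
    rw [hx, hz, Pi.zero_apply, prolateEtaFun]
    exact hall x
  have h1 := norm_prolateEta n
  rw [hη, norm_zero] at h1
  exact zero_ne_one h1

/-- **`λ(0) > 0`** — the case `n = 0` of the printed sign rule `(−1)ⁿλ(n) > 0` (clause 1 of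
`CC2021_sec4_lambda_basic`): `φ_0 = h_{0,1}` has no zero in `(−1, 1)` and `φ_0(0) > 0`, so `φ_0 > 0` there
and `λ(0) = ∫_{−1}^{1} φ_0 / φ_0(0) > 0`.  (The general sign needs Slepian–Pollak's continuation in the band
parameter and is not proved here.) [cite: ConnesConsani2021, §4 p. 16 "`λ(0) = 0.999971`" (arXiv p0016:L22–L25); SlepianPollak1961, §III] -/
theorem prolateEigen_zero_pos : 0 < prolateEigen 0 := by
  have hf := isProlateFunction_prolateFun 0
  have hf0 : IsProlateFunction 1 0 (prolateFun 0) := by simpa using hf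
  rw [prolateEigen_eq_intervalIntegral]
  refine div_pos ?_ (prolateFun_zero_pos 0)
  refine intervalIntegral.intervalIntegral_pos_of_pos_on ?_ (fun x hx => hf0.pos_of_zero hx) (by norm_num)
  refine ContinuousOn.intervalIntegrable ?_
  rw [uIcc_of_le (by norm_num : (-1 : ℝ) ≤ 1)]
  exact hf.contDiffOn.continuousOn

/-- Clause 1 of `CC2021_sec4_lambda_basic` at `n = 0`: `(−1)⁰λ(0) > 0`. [cite: ConnesConsani2021, §4 p. 16 (arXiv p0016:L22–L25)] -/
theorem neg_one_pow_mul_prolateEigen_zero_pos : 0 < (-1 : ℝ) ^ 0 * prolateEigen 0 := by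
  rw [pow_zero, one_mul]; exact prolateEigen_zero_pos

end Sign

/-! ## Append #2: the discharge of `CC2021_sec4_angle_spectrum`

With the completeness fact now a theorem (`CC2021_sec4_xi_complete_holds`, seats t10/t3, module
`ProlateProjectionsCompleteness`), the conditional `CC2021_sec4_angle_spectrum_of_xi_complete` of this file
discharges the named fact outright. -/

section Discharge

/-- **§4 "angle operator" fact DISCHARGED**: `α ξ_n = arccos|λ(n)| ξ_n`, `α η_n = arccos|λ(n)| η_n`, every
non-zero eigenvalue of `α` on `L²(ℝ)_ev` is some `arccos|λ(n)|`, and `α = 0` on Sonin's space — now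
unconditional (the completeness of the `ξ_n` in `𝒫₁ L²_ev` is the tree theorem
`CC2021_sec4_xi_complete_holds`). [cite: ConnesConsani2021, §4 p. 16 eq. (cosalpha), (cosalphan1) (arXiv p0016:L13–L16, L29–L34, L39); Prop. 4.5 (iii) proof p. 17 (arXiv p0017:L41–L57); SlepianPollak1961, §III] -/
theorem CC2021_sec4_angle_spectrum_holds : CC2021_sec4_angle_spectrum :=
  CC2021_sec4_angle_spectrum_of_xi_complete CC2021_sec4_xi_complete_holds

end Discharge

end Literature.NumberTheory.ConnesConsani2021
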